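import Literature.Topology.FourManifolds.KnotsInBall
import Literature.Topology.FourManifolds.ConnectedSumNormalForm
import Literature.Topology.FourManifolds.ChartFieldFlow
import HarnessLib

/-!
# The stereographic chart from the north pole as a full chart; geometry of normal position

Topic `Literature/Topology/FourManifolds` (trunk T-4MAN). Infrastructure for the fact seat
`provefact-Literature.Topology.FourManifolds.Knot.IsConnectedSum.isIsotopic` (Schubert's theorem;
the contraction stage of the proof of the geometric heart shrinks the southern side of a band sum
in normal position by the cut-off homothety flow of `CutoffHomothety.lean`, read in the
stereographic chart **from the north pole**, in which the open southern hemisphere is the open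
ball of radius `2`). Everything here is proved; no named facts are introduced.

* `Literature.Topology.FourManifolds.psiN = stereographic' 3 northPole` and its API: a **full
  chart** (`isFullChart_psiN`: target `ℝ³`, smooth with smooth inverse, `ChartFieldFlow.lean`),
  source the complement of the north pole; `norm_psiN_lt_two_iff` — `‖ψ y‖ < 2 ↔ y₃ < 0` (southern
  hemisphere ↦ `B(0, 2)`), and the monotone relation between `‖ψ y‖` and the last coordinate
  (`norm_psiN_le_iff`: `‖ψ y‖ ≤ r ↔ y₃ ≤ (r² - 4)/(r² + 4)` for `0 ≤ r`), so that the sub-balls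
  `{‖·‖ ≤ r}`, `r < 2`, of the chart are the polar caps `{y₃ ≤ h}`, `h < 0` — **convex** in the
  chart (`segment_subset_closedBall_psiN`: a chord between two points of depth `≥ h` stays at depth
  `≥ h`); `exists_norm_psiN_le_of_isCompact` — a compact subset of the open southern hemisphere
  lies in one such cap.
* Normal position of a band: for `b : BandData A B K avoid` with `A` in the open northern
  hemisphere and the band meeting the equatorial sphere exactly in its middle line
  (`band ⁻¹' sphereEquator 2 ∩ squareNhd δ = {x₀ = 1/2}`), the band maps the half collar
  `{x₀ < 1/2}` into the open northern and `{x₀ > 1/2}` into the open southern hemisphere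
  (`band_last_pos_of_lt_half`, `band_last_neg_of_half_lt`: an intermediate-value argument on the
  convex half collars), and the middle line into the equator (`band_last_eq_zero_of_eq_half`).

## References

* J. M. Lee, *Introduction to Smooth Manifolds*, 2nd ed. (2012), Ex. 1.4, Prop. 1.20
  (stereographic coordinates). [LeeSmoothManifolds2013]
* P. R. Cromwell, *Knots and Links* (2004), §4.6 (the separating sphere of a connected sum).
  [Cromwell2004]
-/

open scoped Manifold ContDiff Topology Real RealInnerProductSpace
open Function Set Metric Filter

noncomputable section

namespace Literature.Topology.FourManifolds

/-- Local notation: `𝔼 n` is the model Euclidean space `EuclideanSpace ℝ (Fin n)`. -/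
local notation "𝔼 " n:arg => EuclideanSpace ℝ (Fin n)

/-- Local notation: `𝕊 n` is the unit sphere in `EuclideanSpace ℝ (Fin (n + 1))`. -/
local notation "𝕊 " n:arg => (Metric.sphere (0 : EuclideanSpace ℝ (Fin (n + 1))) 1)

attribute [local instance] fact_finrank_euclideanSpace_succ

open KnotsInBall

/-! ## The stereographic chart from the north pole -/

/-- **The stereographic chart of `𝕊 3` from the north pole** (southern hemisphere `↦ B(0, 2)`,
south pole `↦ 0`). [cite: LeeSmoothManifolds2013, Ex. 1.4] -/
def psiN : OpenPartialHomeomorph (𝕊 3) (𝔼 3) :=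
  stereographic' 3 northPole

/-- The source of `ψ` is the complement of the north pole. [folklore] -/
theorem psiN_source : psiN.source = {northPole}ᶜ := stereographic'_source _

/-- The target of `ψ` is all of `ℝ³`. [folklore] -/
theorem psiN_target : psiN.target = univ := stereographic'_target _

/-- `ψ` is smooth on its source. [folklore] -/
theorem contMDiffOn_psiN : ContMDiffOn (𝓡 3) (𝓡 3) ∞ psiN psiN.source := by
  rw [psiN_source]; exact contMDiffOn_stereographic' _

/-- `ψ⁻¹` is smooth on `ℝ³`. [folklore] -/
theorem contMDiff_psiN_symm : ContMDiff (𝓡 3) (𝓡 3) ∞ psiN.symm :=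
  contMDiff_stereographic'_symm _

/-- **`ψ` is a full chart** (`ChartFieldFlow.lean`): flows of compactly supported vector fields
of `ℝ³` transport along it to ambient isotopies of `𝕊 3`. [folklore] -/
theorem isFullChart_psiN : IsFullChart psiN where
  target_eq := psiN_target
  contMDiffOn := contMDiffOn_psiN
  contMDiff_symm := contMDiff_psiN_symm

/-- Points with last coordinate `< 1` are not the north pole. [folklore] -/
theorem ne_northPole_of_lt {y : 𝕊 3} (hy : (y : 𝔼 4) (Fin.last 3) < 1) : y ≠ northPole := by
  rintro rfl; rw [northPole_apply_last] at hy; exact lt_irrefl _ hy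

/-- Points with nonpositive last coordinate are not the north pole. [folklore] -/
theorem ne_northPole_of_nonpos {y : 𝕊 3} (hy : (y : 𝔼 4) (Fin.last 3) ≤ 0) : y ≠ northPole :=
  ne_northPole_of_lt (by linarith)

/-- Points other than the north pole lie in the source of `ψ`. [folklore] -/
theorem mem_psiN_source {y : 𝕊 3} (hy : y ≠ northPole) : y ∈ psiN.source := by
  rw [psiN_source]; exact hy

/-- `ψ⁻¹ (ψ y) = y` off the north pole. [folklore] -/
theorem psiN_symm_apply_psiN {y : 𝕊 3} (hy : y ≠ northPole) : psiN.symm (psiN y) = y :=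
  psiN.left_inv (mem_psiN_source hy)

/-- `ψ (ψ⁻¹ w) = w`. [folklore] -/
theorem psiN_apply_psiN_symm (w : 𝔼 3) : psiN (psiN.symm w) = w :=
  psiN.right_inv (by rw [psiN_target]; trivial)

/-- `ψ⁻¹ w` is never the north pole. [folklore] -/
theorem psiN_symm_ne_northPole (w : 𝔼 3) : psiN.symm w ≠ northPole := by
  have : psiN.symm w ∈ psiN.source := psiN.map_target (by rw [psiN_target]; trivial)
  rwa [psiN_source] at this

/-- `ψ` is injective off the north pole. [folklore] -/
theorem psiN_injOn : InjOn psiN {northPole}ᶜ := by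
  rw [← psiN_source]; exact psiN.injOn

/-- `ψ` is continuous at every point other than the north pole. [folklore] -/
theorem continuousAt_psiN {y : 𝕊 3} (hy : y ≠ northPole) : ContinuousAt psiN y :=
  psiN.continuousAt (mem_psiN_source hy)

/-- **In the chart from the north pole, the open southern hemisphere is the ball of radius `2`.**
[cite: LeeSmoothManifolds2013, Ex. 1.4] -/
theorem norm_psiN_lt_two_iff {y : 𝕊 3} (hy : y ≠ northPole) :
    ‖psiN y‖ < 2 ↔ (y : 𝔼 4) (Fin.last 3) < 0 := by
  rw [psiN, norm_stereographic'_lt_two_iff northPole y hy, inner_northPole]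

/-- The basic identity `‖ψ y‖² (1 - y₃) = 4 (1 + y₃)`. [cite: LeeSmoothManifolds2013, Ex. 1.4] -/
theorem norm_psiN_sq_mul {y : 𝕊 3} (hy : y ≠ northPole) :
    ‖psiN y‖ ^ 2 * (1 - (y : 𝔼 4) (Fin.last 3)) = 4 * (1 + (y : 𝔼 4) (Fin.last 3)) := by
  have h := norm_stereographic'_sq_mul (n := 3) northPole y hy
  rwa [inner_northPole] at h

/-- The last coordinate of a point of the sphere other than the north pole is `< 1`. [folklore] -/
theorem last_lt_one {y : 𝕊 3} (hy : y ≠ northPole) : (y : 𝔼 4) (Fin.last 3) < 1 := by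
  have h := inner_lt_one_of_ne_pole northPole y hy
  rwa [inner_northPole] at h

/-- **The norm in the chart is a monotone function of the last coordinate**: for `0 ≤ r`,
`‖ψ y‖ ≤ r ↔ y₃ ≤ (r² - 4)/(r² + 4)`. [folklore] -/
theorem norm_psiN_le_iff {y : 𝕊 3} (hy : y ≠ northPole) {r : ℝ} (hr : 0 ≤ r) :
    ‖psiN y‖ ≤ r ↔ (y : 𝔼 4) (Fin.last 3) ≤ (r ^ 2 - 4) / (r ^ 2 + 4) := by
  have h := norm_psiN_sq_mul hy
  have h1 := last_lt_one hy
  set a := (y : 𝔼 4) (Fin.last 3) with ha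
  have hpos : 0 < 1 - a := by linarith
  have hsq : ‖psiN y‖ ^ 2 = 4 * (1 + a) / (1 - a) := by
    rw [eq_div_iff hpos.ne']; exact h
  have hr4 : 0 < r ^ 2 + 4 := by positivity
  constructor
  · intro hle
    have h2 : ‖psiN y‖ ^ 2 ≤ r ^ 2 := pow_le_pow_left₀ (norm_nonneg _) hle 2
    rw [hsq, div_le_iff₀ hpos] at h2
    rw [le_div_iff₀ hr4]
    nlinarith
  · intro hle
    rw [le_div_iff₀ hr4] at hle
    have h2 : ‖psiN y‖ ^ 2 ≤ r ^ 2 := by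
      rw [hsq, div_le_iff₀ hpos]; nlinarith
    exact (pow_le_pow_iff_left₀ (norm_nonneg _) hr two_ne_zero).1 h2

/-- The cap level of radius `r`: `capLevel r = (r² - 4)/(r² + 4)`, negative for `r < 2`,
increasing in `r ≥ 0`. [folklore] -/
def capLevel (r : ℝ) : ℝ := (r ^ 2 - 4) / (r ^ 2 + 4)

/-- The cap level is negative for `0 ≤ r < 2`. [folklore] -/
theorem capLevel_neg {r : ℝ} (hr : 0 ≤ r) (hr2 : r < 2) : capLevel r < 0 := by
  rw [capLevel, div_neg_iff]
  right
  exact ⟨by nlinarith, by positivity⟩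

/-- **Convexity of the caps in the chart**: a chord of the ball `B̄(0, r)` stays in it; in terms of
the sphere, a chord (in the chart) between two points of depth at least that of the cap of radius
`r` stays in the cap. [folklore] -/
theorem segment_subset_closedBall_psiN {r : ℝ} {w₁ w₂ : 𝔼 3} (h₁ : ‖w₁‖ ≤ r) (h₂ : ‖w₂‖ ≤ r) :
    segment ℝ w₁ w₂ ⊆ closedBall (0 : 𝔼 3) r :=
  (convex_closedBall (0 : 𝔼 3) r).segment_subset (by simpa using h₁) (by simpa using h₂)

/-- A point of a chord of `B̄(0, r)` read back on the sphere has last coordinate at most the cap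
level. [folklore] -/
theorem last_le_capLevel_of_mem_segment {r : ℝ} (hr : 0 ≤ r) {w₁ w₂ w : 𝔼 3} (h₁ : ‖w₁‖ ≤ r)
    (h₂ : ‖w₂‖ ≤ r) (hw : w ∈ segment ℝ w₁ w₂) :
    ((psiN.symm w : 𝕊 3) : 𝔼 4) (Fin.last 3) ≤ capLevel r := by
  have hmem := segment_subset_closedBall_psiN h₁ h₂ hw
  rw [mem_closedBall, dist_zero_right] at hmem
  have h := (norm_psiN_le_iff (psiN_symm_ne_northPole w) hr).1 (by rwa [psiN_apply_psiN_symm])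
  exact h

/-- **A compact subset of the open southern hemisphere lies in a cap**: there is `r < 2` with
`‖ψ y‖ ≤ r` on it. [folklore] -/
theorem exists_norm_psiN_le_of_isCompact {C : Set (𝕊 3)} (hC : IsCompact C)
    (hS : ∀ y ∈ C, (y : 𝔼 4) (Fin.last 3) < 0) : ∃ r, 0 ≤ r ∧ r < 2 ∧ ∀ y ∈ C, ‖psiN y‖ ≤ r := by
  rcases C.eq_empty_or_nonempty with rfl | hne
  · exact ⟨0, le_rfl, by norm_num, fun _ h ↦ h.elim⟩
  have hcont : ContinuousOn (fun y ↦ ‖psiN y‖) C := by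
    refine continuous_norm.comp_continuousOn (fun y hy ↦ ?_)
    exact (continuousAt_psiN (ne_northPole_of_lt (by linarith [hS y hy]))).continuousWithinAt
  obtain ⟨y₀, hy₀, hmax⟩ := hC.exists_isMaxOn hne hcont
  refine ⟨‖psiN y₀‖, norm_nonneg _, (norm_psiN_lt_two_iff (ne_northPole_of_lt (by linarith [hS y₀ hy₀]))).2
    (hS y₀ hy₀), fun y hy ↦ hmax hy⟩

/-! ## Normal position of a band: the two half collars go to the two hemispheres -/

namespace BandData

variable {A B K : Knot} {avoid : Set (𝕊 3)} (b : BandData A B K avoid)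

/-- The last coordinate of the band is continuous. [folklore] -/
theorem continuous_band_last : Continuous fun x : 𝔼 2 ↦ ((b.band x : 𝕊 3) : 𝔼 4) (Fin.last 3) :=
  ((EuclideanSpace.proj (Fin.last 3) : 𝔼 4 →L[ℝ] ℝ).continuous).comp
    (continuous_subtype_val.comp b.contMDiff.continuous)

/-- In normal position, the points of the collar where the band meets the equator are exactly
those of the middle line. [folklore] -/
theorem band_last_eq_zero_iff (hcross : b.band ⁻¹' sphereEquator 2 ∩ squareNhd b.δ = {x ∈ squareNhd b.δ | x 0 = 2⁻¹})
    {x : 𝔼 2} (hx : x ∈ squareNhd b.δ) : ((b.band x : 𝕊 3) : 𝔼 4) (Fin.last 3) = 0 ↔ x 0 = 2⁻¹ := by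
  have h : x ∈ b.band ⁻¹' sphereEquator 2 ∩ squareNhd b.δ ↔ x ∈ {x ∈ squareNhd b.δ | x 0 = 2⁻¹} := by
    rw [hcross]
  simp only [mem_inter_iff, mem_preimage, mem_sphereEquator_iff, mem_setOf_eq] at h
  constructor
  · intro h0; exact (h.1 ⟨h0, hx⟩).2
  · intro h0; exact (h.2 ⟨hx, h0⟩).1

/-- **The middle line goes to the equator.** [folklore] -/
theorem band_last_eq_zero_of_eq_half (hcross : b.band ⁻¹' sphereEquator 2 ∩ squareNhd b.δ = {x ∈ squareNhd b.δ | x 0 = 2⁻¹})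
    {x : 𝔼 2} (hx : x ∈ squareNhd b.δ) (h0 : x 0 = 2⁻¹) : ((b.band x : 𝕊 3) : 𝔼 4) (Fin.last 3) = 0 :=
  (b.band_last_eq_zero_iff hcross hx).2 h0

/-- The left half collar `{x ∈ squareNhd δ | x₀ < 1/2}` is convex. [folklore] -/
theorem convex_leftHalf : Convex ℝ {x : 𝔼 2 | x ∈ squareNhd b.δ ∧ x 0 < 2⁻¹} := by
  have h1 : Convex ℝ (squareNhd b.δ) := by
    have : squareNhd b.δ = ⋂ i, (fun x : 𝔼 2 ↦ x i) ⁻¹' Ioo (-b.δ) (1 + b.δ) := by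
      ext x; simp [mem_squareNhd_iff]
    rw [this]
    exact convex_iInter fun i ↦ (convex_Ioo _ _).linear_preimage (EuclideanSpace.proj i).toLinearMap
  have h2 : Convex ℝ {x : 𝔼 2 | x 0 < 2⁻¹} :=
    (convex_Iio (2⁻¹ : ℝ)).linear_preimage (EuclideanSpace.proj (0 : Fin 2)).toLinearMap
  have e : {x : 𝔼 2 | x ∈ squareNhd b.δ ∧ x 0 < 2⁻¹} = squareNhd b.δ ∩ {x : 𝔼 2 | x 0 < 2⁻¹} := by
    ext x; simp
  rw [e]; exact h1.inter h2

/-- The right half collar `{x ∈ squareNhd δ | 1/2 < x₀}` is convex. [folklore] -/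
theorem convex_rightHalf : Convex ℝ {x : 𝔼 2 | x ∈ squareNhd b.δ ∧ 2⁻¹ < x 0} := by
  have h1 : Convex ℝ (squareNhd b.δ) := by
    have : squareNhd b.δ = ⋂ i, (fun x : 𝔼 2 ↦ x i) ⁻¹' Ioo (-b.δ) (1 + b.δ) := by
      ext x; simp [mem_squareNhd_iff]
    rw [this]
    exact convex_iInter fun i ↦ (convex_Ioo _ _).linear_preimage (EuclideanSpace.proj i).toLinearMap
  have h2 : Convex ℝ {x : 𝔼 2 | 2⁻¹ < x 0} :=
    (convex_Ioi (2⁻¹ : ℝ)).linear_preimage (EuclideanSpace.proj (0 : Fin 2)).toLinearMap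
  have e : {x : 𝔼 2 | x ∈ squareNhd b.δ ∧ 2⁻¹ < x 0} = squareNhd b.δ ∩ {x : 𝔼 2 | 2⁻¹ < x 0} := by
    ext x; simp
  rw [e]; exact h1.inter h2

/-- **In normal position the band maps the left half collar into the open northern hemisphere**
(the last coordinate does not vanish on the convex half collar and is positive at the point
`(0, 1/2)` of `A`; intermediate value theorem). [cite: Cromwell2004, §4.6] -/
theorem band_last_pos_of_lt_half (hA : A.InNorth)
    (hcross : b.band ⁻¹' sphereEquator 2 ∩ squareNhd b.δ = {x ∈ squareNhd b.δ | x 0 = 2⁻¹})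
    {x : 𝔼 2} (hx : x ∈ squareNhd b.δ) (h0 : x 0 < 2⁻¹) : 0 < ((b.band x : 𝕊 3) : 𝔼 4) (Fin.last 3) := by
  set f : 𝔼 2 → ℝ := fun x ↦ ((b.band x : 𝕊 3) : 𝔼 4) (Fin.last 3) with hf
  set U : Set (𝔼 2) := {x : 𝔼 2 | x ∈ squareNhd b.δ ∧ x 0 < 2⁻¹} with hU
  have hδ := b.δ_pos
  -- the reference point `(0, 1/2)` lies on `A`, hence in the north
  set p : 𝔼 2 := pt2 0 2⁻¹ with hp
  have hpU : p ∈ U := by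
    refine ⟨?_, by simp [hp, pt2_apply_zero]⟩
    rw [mem_squareNhd_iff, Fin.forall_fin_two]
    exact ⟨⟨by simp [hp, pt2_apply_zero]; linarith, by simp [hp, pt2_apply_zero]; linarith⟩,
      ⟨by simp [hp, pt2_apply_one]; linarith, by simp [hp, pt2_apply_one]; linarith⟩⟩
  have hpA : b.band p ∈ range A := by
    have : p ∈ b.band ⁻¹' range A ∩ squareNhd b.δ := by
      rw [b.preimage_left]; exact ⟨hpU.1, by simp [hp, pt2_apply_zero]⟩
    exact this.1
  have hfp : 0 < f p := by
    obtain ⟨θ, hθ⟩ := hpA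
    have := hA θ
    rw [hθ] at this
    exact this
  -- `f` does not vanish on `U`
  have hne : ∀ y ∈ U, f y ≠ 0 := by
    intro y hy h
    have := (b.band_last_eq_zero_iff hcross hy.1).1 h
    linarith [hy.2]
  -- intermediate value theorem on the connected set `U`
  by_contra hle
  push Not at hle
  have hconn : IsPreconnected U := b.convex_leftHalf.isPreconnected
  have hcont : ContinuousOn f U := b.continuous_band_last.continuousOn
  have hxU : x ∈ U := ⟨hx, h0⟩
  have h := hconn.intermediate_value hxU hpU hcont ⟨hle, hfp.le⟩
  obtain ⟨z, hz, hz0⟩ := h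
  exact hne z hz hz0

/-- **In normal position the band maps the right half collar into the open southern hemisphere**
(same argument from the point `(1, 1/2)` of `B`). [cite: Cromwell2004, §4.6] -/
theorem band_last_neg_of_half_lt (hB : B.InSouth)
    (hcross : b.band ⁻¹' sphereEquator 2 ∩ squareNhd b.δ = {x ∈ squareNhd b.δ | x 0 = 2⁻¹})
    {x : 𝔼 2} (hx : x ∈ squareNhd b.δ) (h0 : 2⁻¹ < x 0) : ((b.band x : 𝕊 3) : 𝔼 4) (Fin.last 3) < 0 := by
  set f : 𝔼 2 → ℝ := fun x ↦ ((b.band x : 𝕊 3) : 𝔼 4) (Fin.last 3) with hf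
  set U : Set (𝔼 2) := {x : 𝔼 2 | x ∈ squareNhd b.δ ∧ 2⁻¹ < x 0} with hU
  have hδ := b.δ_pos
  set p : 𝔼 2 := pt2 1 2⁻¹ with hp
  have hpU : p ∈ U := by
    refine ⟨?_, by simp [hp, pt2_apply_zero]; norm_num⟩
    rw [mem_squareNhd_iff, Fin.forall_fin_two]
    exact ⟨⟨by simp [hp, pt2_apply_zero]; linarith, by simp [hp, pt2_apply_zero]; linarith⟩,
      ⟨by simp [hp, pt2_apply_one]; linarith, by simp [hp, pt2_apply_one]; linarith⟩⟩
  have hpB : b.band p ∈ range B := by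
    have : p ∈ b.band ⁻¹' range B ∩ squareNhd b.δ := by
      rw [b.preimage_right]; exact ⟨hpU.1, by simp [hp, pt2_apply_zero]⟩
    exact this.1
  have hfp : f p < 0 := by
    obtain ⟨θ, hθ⟩ := hpB
    have := hB θ
    rw [hθ] at this
    exact this
  have hne : ∀ y ∈ U, f y ≠ 0 := by
    intro y hy h
    have := (b.band_last_eq_zero_iff hcross hy.1).1 h
    linarith [hy.2]
  by_contra hle
  push Not at hle
  have hconn : IsPreconnected U := b.convex_rightHalf.isPreconnected
  have hcont : ContinuousOn f U := b.continuous_band_last.continuousOn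
  have hxU : x ∈ U := ⟨hx, h0⟩
  have h := hconn.intermediate_value hpU hxU hcont ⟨hfp.le, hle⟩
  obtain ⟨z, hz, hz0⟩ := h
  exact hne z hz hz0

/-- In normal position the band points on or right of the middle line are not the north pole.
[folklore] -/
theorem band_ne_northPole_of_half_le (hB : B.InSouth)
    (hcross : b.band ⁻¹' sphereEquator 2 ∩ squareNhd b.δ = {x ∈ squareNhd b.δ | x 0 = 2⁻¹})
    {x : 𝔼 2} (hx : x ∈ squareNhd b.δ) (h0 : 2⁻¹ ≤ x 0) : b.band x ≠ northPole := by
  rcases h0.eq_or_lt with h | h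
  · exact ne_northPole_of_nonpos (b.band_last_eq_zero_of_eq_half hcross hx h.symm).le
  · exact ne_northPole_of_nonpos (b.band_last_neg_of_half_lt hB hcross hx h).le

end BandData

end Literature.Topology.FourManifolds
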